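import Mathlib
import Summits.KontsevichZagierPeriods.KontsevichZagierPeriods.Theorems.InverseLandauTateLiftingDimOneCells
import Summits.KontsevichZagierPeriods.KontsevichZagierPeriods.Theorems.InverseLandauTateLiftingDimOneUnitKernel
import Summits.KontsevichZagierPeriods.KontsevichZagierPeriods.Theorems.InverseLandauTateLiftingDimZeroSector
import Summits.KontsevichZagierPeriods.KontsevichZagierPeriods.Theorems.InverseLandauTateLiftingDimOneAlgCompactify
import Summits.KontsevichZagierPeriods.KontsevichZagierPeriods.Theorems.InverseLandauTateLiftingDimOneAlgUnitChart
import Summits.KontsevichZagierPeriods.KontsevichZagierPeriods.Theorems.InverseLandauTateLiftingDimZeroLiftAlg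

/-!
# `TateLifting` (stmt-KontsevichZagierPeriods-9129), line `Sketch` — dimension ≤ 1 with algebraic
coefficients, and dimension 0 unconditionally

Crux `Summit.KontsevichZagierPeriods.KontsevichZagierPeriods.Theses.InverseLandau.TateLifting`
(`ker KZ.eval ⊆ KZ.relations ⊔ closure T`, `T` = Tate fibres) is Conjecture-1-strength in general; the
line lands the SECTORS on which it is a theorem. The dimension-one KZ-rational sector
(`Theorems/InverseLandauTateLiftingDimOneSector.lean`, integrands `p/q` with `p, q ∈ ℚ[x]`) is extended
here to

* `tateLifting_dimOneAlgSector` — every vanishing `ℤ`-combination of dimension-one representations whose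
  integrand is `P/Q` on the domain, `P, Q ∈ ℝ[x]` with real-ALGEBRAIC coefficients, `Q ≠ 0` on the
  (arbitrary `ℚ`-semialgebraic) domain, lies in `KZ.relations` (KZ's remark "rational may be replaced by
  algebraic", in dimension one, at the level of representations);
* `TateLifting_dimOneAlgSector` — hence in `KZ.relations ⊔ closure T` (the crux on this sector);
* `kzPeriodConjecture_dim_zero` — two representations over `ℝ⁰` with the same value are KZ-equivalent,
  with NO rationality hypothesis and no transcendence input (verbatim the statement of the support item
  `LowdimDimZero` of route LowDimension, stmt-KontsevichZagierPeriods-0119);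
* `kzKernelConjecture_lowDimAlg` — the kernel form of Conjecture 1 on the subgroup of `KZ.FormalRep`
  generated by ALL representations of dimension `0` and the algebraic-coefficient representations of
  dimension `1`;
* `kzPeriodConjecture_dim_one_algCoeff`, `kzPeriodConjecture_dim_one_rational_algCoeff`,
  `kzPeriodConjecture_dim_zero_one_algCoeff` — the two-representation forms (1–1, rational–algebraic, 0–1).

Spine: compactification with algebraic coefficients (`tateLifting_dimOneAlgCompactify`, Viu-Sos step (a):
projective charts `x ↦ 1/x` on the outer pieces) ⟶ 1-cells with algebraic break points
(`tateLifting_dimOneCells`) ⟶ unit chart of every cell (`tateLifting_dimOneAlgUnitChart`) ⟶ flattening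
and transport of the vanishing evaluation (soundness `KZ.relations_le_ker_eval_holds`) ⟶ unit-form
kernel (`tateLifting_dimOneUnitKernel`, resting on Baker's theorem `baker_holds`); dimension zero by
`tateLifting_dimZeroSector` (Baker-free) and the unconditional lift `tateLifting_dimZeroLiftAlg`.

References: M. Kontsevich, D. Zagier, *Periods* (2001), §§1.1–1.2; A. Baker, *Transcendental Number
Theory* (1975), Thm 2.1; J. Viu-Sos, Int. J. Number Theory 17 (2021), Thm. 2.1, §2.3.
-/

noncomputable section

namespace Summit.KontsevichZagierPeriods.InverseLandau

open MeasureTheory Set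
open Literature.NumberTheory.Transcendental

namespace DimOne

/-- A KZ-rational integrand of dimension one has an algebraic-coefficient reading: the
`ℚ`-polynomials `p, q ∈ ℚ[x₀]` read as real univariate polynomials (with rational, hence algebraic,
coefficients). [folklore] -/
theorem las_exists_algReading_of_isRational (r : KZ.IntegralRep 1) (hr : r.IsRational) :
    ∃ p q : Polynomial ℝ, (∀ i, IsAlgebraic ℚ (p.coeff i)) ∧ (∀ i, IsAlgebraic ℚ (q.coeff i)) ∧
      (∀ x ∈ r.domain, q.eval (x 0) ≠ 0) ∧
      Set.EqOn r.integrand (fun x => p.eval (x 0) / q.eval (x 0)) r.domain := by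
  obtain ⟨p, q, hq, hpq⟩ := hr
  set P : Polynomial ℝ := (MvPolynomial.aeval (fun _ : Fin 1 => (Polynomial.X : Polynomial ℚ)) p).map
    (algebraMap ℚ ℝ) with hP
  set Q : Polynomial ℝ := (MvPolynomial.aeval (fun _ : Fin 1 => (Polynomial.X : Polynomial ℚ)) q).map
    (algebraMap ℚ ℝ) with hQ
  have hev : ∀ (f : MvPolynomial (Fin 1) ℚ) (x : Fin 1 → ℝ), MvPolynomial.aeval x f =
      ((MvPolynomial.aeval (fun _ : Fin 1 => (Polynomial.X : Polynomial ℚ)) f).map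
        (algebraMap ℚ ℝ)).eval (x 0) := by
    intro f x
    have hx : x = fun _ => x 0 := KZ.eq_const_apply_zero x
    rw [Polynomial.eval_map, ← Polynomial.aeval_def, ← AlgHom.comp_apply, MvPolynomial.comp_aeval]
    conv_lhs => rw [hx]
    simp
  have hcoeff : ∀ (f : Polynomial ℚ) (i : ℕ), IsAlgebraic ℚ ((f.map (algebraMap ℚ ℝ)).coeff i) := by
    intro f i
    rw [Polynomial.coeff_map]
    exact isAlgebraic_algebraMap _
  refine ⟨P, Q, fun i => hcoeff _ i, fun i => hcoeff _ i, fun x hx => ?_, fun x hx => ?_⟩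
  · rw [hQ, ← hev]
    exact hq x hx
  · rw [hpq hx]
    beta_reduce
    rw [hP, hQ, ← hev, ← hev]

end DimOne

/-- **The dimension-one sector with algebraic coefficients, kernel form.** Every vanishing
`ℤ`-combination of dimension-one integral representations with integrands `pᵢ/qᵢ` on their domains,
`pᵢ, qᵢ ∈ ℝ[x]` with real-algebraic coefficients, `qᵢ ≠ 0` on the (arbitrary `ℚ`-semialgebraic) domain,
is a relation of the Kontsevich–Zagier calculus: compactify (`tateLifting_dimOneAlgCompactify`), cut the
bounded pieces into 1-cells (`tateLifting_dimOneCells`; a cell inherits the reading of its piece), put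
every cell in unit form (`tateLifting_dimOneAlgUnitChart`), flatten the bookkeeping in the free abelian
group, transport the vanishing of the evaluation along the relations used (soundness
`KZ.relations_le_ker_eval_holds`), and apply the unit-form kernel (`tateLifting_dimOneUnitKernel`, which
rests on Baker's theorem). [cite: Baker1975, Thm 2.1] -/
theorem tateLifting_dimOneAlgSector :
    ∀ (s : ℕ) (m : Fin s → ℤ) (r : Fin s → KZ.IntegralRep 1) (p q : Fin s → Polynomial ℝ),
      (∀ i n, IsAlgebraic ℚ ((p i).coeff n)) → (∀ i n, IsAlgebraic ℚ ((q i).coeff n)) →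
      (∀ i, ∀ x ∈ (r i).domain, (q i).eval (x 0) ≠ 0) →
      (∀ i, Set.EqOn (r i).integrand (fun x => (p i).eval (x 0) / (q i).eval (x 0)) (r i).domain) →
      KZ.eval (∑ i, m i • KZ.of (r i)) = 0 → ∑ i, m i • KZ.of (r i) ∈ KZ.relations := by
  intro s m r p q hp hq hq0 hpq hev
  classical
  -- Step 1: compactify: `[r i] ≡ Σ_j [R i j]`, `R i j` alg-rational on a bounded domain
  choose k R P Q hRb hPa hQa hQ0 hRi hRrel using fun i =>
    tateLifting_dimOneAlgCompactify (r i) (p i) (q i) (hp i) (hq i) (hq0 i) (hpq i)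
  -- Step 2: 1-cells of every bounded piece
  choose kc u v ρ halg hρd hρsub hρi hρrel using fun i j => tateLifting_dimOneCells (R i j) (hRb i j)
  -- Step 3: unit chart of every cell (the cell inherits the reading of its piece)
  have hρQ0 : ∀ i j l, ∀ x ∈ (ρ i j l).domain, (Q i j).eval (x 0) ≠ 0 := fun i j l x hx =>
    hQ0 i j x (hρsub i j l hx)
  have hρread : ∀ i j l, Set.EqOn (ρ i j l).integrand
      (fun x => (P i j).eval (x 0) / (Q i j).eval (x 0)) (ρ i j l).domain := fun i j l x hx => by
    rw [hρi i j l]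
    exact hRi i j (hρsub i j l hx)
  choose P' Q' ρ' hP' hQ' hQ'0 hρ'd hρ'i hρ'rel using fun i j l =>
    tateLifting_dimOneAlgUnitChart (u i j l) (v i j l) (halg i j l).1 (halg i j l).2.1
      (halg i j l).2.2 (ρ i j l) (P i j) (Q i j) (hρd i j l) (hPa i j) (hQa i j) (hρQ0 i j l)
      (hρread i j l)
  -- Step 4: flatten the index set `Σ i, Σ j, Fin (kc i j)` to `Fin K`
  obtain ⟨K, ⟨e⟩⟩ := Finite.exists_equiv_fin (Σ i : Fin s, Σ j : Fin (k i), Fin (kc i j))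
  have hsum : ∑ l : Fin K, m (e.symm l).1 • KZ.of (ρ' (e.symm l).1 (e.symm l).2.1 (e.symm l).2.2) =
      ∑ i, m i • ∑ j, ∑ l, KZ.of (ρ' i j l) := by
    have e1 : ∑ l : Fin K, m (e.symm l).1 • KZ.of (ρ' (e.symm l).1 (e.symm l).2.1 (e.symm l).2.2) =
        ∑ x : (Σ i : Fin s, Σ j : Fin (k i), Fin (kc i j)), m x.1 • KZ.of (ρ' x.1 x.2.1 x.2.2) :=
      Fintype.sum_equiv e.symm _ _ fun l => rfl
    rw [e1]
    simp only [Fintype.sum_sigma, Finset.smul_sum]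
  -- Step 5: the difference with the original combination is a relation
  have hdiff : ∑ i, m i • KZ.of (r i) - ∑ i, m i • ∑ j, ∑ l, KZ.of (ρ' i j l) ∈ KZ.relations := by
    rw [← Finset.sum_sub_distrib]
    refine sum_mem fun i _ => ?_
    rw [← smul_sub]
    refine KZ.relations.zsmul_mem ?_ _
    have h1 : ∀ j, KZ.of (R i j) - ∑ l, KZ.of (ρ' i j l) ∈ KZ.relations := fun j => by
      have h2 : ∑ l, KZ.of (ρ i j l) - ∑ l, KZ.of (ρ' i j l) ∈ KZ.relations := by
        rw [← Finset.sum_sub_distrib]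
        exact sum_mem fun l _ => hρ'rel i j l
      have h3 := KZ.relations.add_mem (hρrel i j) h2
      rwa [sub_add_sub_cancel] at h3
    have h4 : ∑ j, KZ.of (R i j) - ∑ j, ∑ l, KZ.of (ρ' i j l) ∈ KZ.relations := by
      rw [← Finset.sum_sub_distrib]
      exact sum_mem fun j _ => h1 j
    have h5 := KZ.relations.add_mem (hRrel i) h4
    rwa [sub_add_sub_cancel] at h5
  -- Step 6: the flattened combination has vanishing evaluation (soundness of the moves)
  have hev' : KZ.eval (∑ l : Fin K, m (e.symm l).1 •
      KZ.of (ρ' (e.symm l).1 (e.symm l).2.1 (e.symm l).2.2)) = 0 := by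
    have h0 := KZ.relations_le_ker_eval_holds hdiff
    rw [AddMonoidHom.mem_ker, map_sub, hev, zero_sub, neg_eq_zero] at h0
    rw [hsum, h0]
  -- Step 7: the unit-form kernel, and reassembly
  have hker := tateLifting_dimOneUnitKernel K (fun l => m (e.symm l).1)
    (fun l => P' (e.symm l).1 (e.symm l).2.1 (e.symm l).2.2)
    (fun l => Q' (e.symm l).1 (e.symm l).2.1 (e.symm l).2.2)
    (fun l => ρ' (e.symm l).1 (e.symm l).2.1 (e.symm l).2.2)
    (fun l n => hP' _ _ _ n) (fun l n => hQ' _ _ _ n) (fun l => hQ'0 _ _ _) (fun l => hρ'd _ _ _)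
    (fun l => hρ'i _ _ _) hev'
  rw [hsum] at hker
  have h := KZ.relations.add_mem hdiff hker
  rwa [sub_add_cancel] at h

/-- **The crux `TateLifting` on the dimension-one sector with algebraic coefficients.** Every vanishing
`ℤ`-combination of dimension-one representations with algebraic-coefficient rational integrands lies in
`KZ.relations ⊔ closure T`, `T` the crux's set of Tate fibres (verbatim) — indeed in `KZ.relations`.
[cite: Baker1975, Thm 2.1] -/
theorem TateLifting_dimOneAlgSector :
    ∀ (s : ℕ) (m : Fin s → ℤ) (r : Fin s → KZ.IntegralRep 1) (p q : Fin s → Polynomial ℝ),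
      (∀ i n, IsAlgebraic ℚ ((p i).coeff n)) → (∀ i n, IsAlgebraic ℚ ((q i).coeff n)) →
      (∀ i, ∀ x ∈ (r i).domain, (q i).eval (x 0) ≠ 0) →
      (∀ i, Set.EqOn (r i).integrand (fun x => (p i).eval (x 0) / (q i).eval (x 0)) (r i).domain) →
      KZ.eval (∑ i, m i • KZ.of (r i)) = 0 →
      ∑ i, m i • KZ.of (r i) ∈ KZ.relations ⊔ AddSubgroup.closure
        {d : KZ.FormalRep | ∃ (n : ℕ) (P Q : MvPolynomial (Fin (n + 1)) ℚ) (ε ϖ₀ : ℝ)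
            (r : KZ.IntegralRep n), 0 < ε ∧
          (∃ c₀ : ℚ, c₀ ≠ 0 ∧ ∀ z : Fin n → ℝ,
            MvPolynomial.aeval (Fin.snoc z (0 : ℝ) : Fin (n + 1) → ℝ) Q = (c₀ : ℝ)) ∧
          (∀ (z : Fin n → ℝ) (ϖ : ℝ), (∀ i, z i ∈ Set.Icc (0 : ℝ) 1) → ϖ ∈ Set.Ioo 0 ε →
            MvPolynomial.aeval (Fin.snoc z ϖ : Fin (n + 1) → ℝ) Q ≠ 0) ∧
          (∀ ϖ ∈ Set.Ioo (0 : ℝ) ε, ∫ z in Set.pi Set.univ (fun _ : Fin n => Set.Ioo (0 : ℝ) 1),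
            MvPolynomial.aeval (Fin.snoc z ϖ : Fin (n + 1) → ℝ) P /
              MvPolynomial.aeval (Fin.snoc z ϖ : Fin (n + 1) → ℝ) Q = 0) ∧
          IsAlgebraic ℚ ϖ₀ ∧ ϖ₀ ∈ Set.Ioo 0 ε ∧
          r.domain = Set.pi Set.univ (fun _ : Fin n => Set.Ioo (0 : ℝ) 1) ∧
          Set.EqOn r.integrand (fun z => MvPolynomial.aeval (Fin.snoc z ϖ₀ : Fin (n + 1) → ℝ) P /
            MvPolynomial.aeval (Fin.snoc z ϖ₀ : Fin (n + 1) → ℝ) Q) r.domain ∧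
          d = KZ.of r} :=
  fun s m r p q hp hq hq0 hpq hev =>
    AddSubgroup.mem_sup_left (tateLifting_dimOneAlgSector s m r p q hp hq hq0 hpq hev)

/-- **Conjecture 1 in dimension `0`, unconditionally.** Two integral representations over the point
`ℝ⁰` with the same value are KZ-equivalent — no rationality hypothesis, no transcendence input (the
Baker-free dimension-zero sector `tateLifting_dimZeroSector` on the combination `[r] − [r']`). This is
verbatim the statement of the support item `LowdimDimZero` of route LowDimension
(stmt-KontsevichZagierPeriods-0119). [cite: KontsevichZagier2001, §1.2] -/
theorem kzPeriodConjecture_dim_zero :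
    ∀ (r r' : KZ.IntegralRep 0), r.value = r'.value → KZ.Equivalent r r' := by
  intro r r' hv
  have e : ∑ i : Fin 2, (![1, -1] : Fin 2 → ℤ) i • KZ.of ((![r, r'] : Fin 2 → KZ.IntegralRep 0) i) =
      KZ.of r - KZ.of r' := by
    rw [Fin.sum_univ_two]
    simp only [Matrix.cons_val_zero, Matrix.cons_val_one, one_smul, neg_smul, sub_eq_add_neg]
  have hev : KZ.eval (∑ i : Fin 2, (![1, -1] : Fin 2 → ℤ) i •
      KZ.of ((![r, r'] : Fin 2 → KZ.IntegralRep 0) i)) = 0 := by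
    rw [e, map_sub, KZ.eval_of, KZ.eval_of, hv, sub_self]
  have hmem := tateLifting_dimZeroSector 2 ![1, -1] ![r, r'] hev
  rwa [e] at hmem

/-- **The kernel form of Conjecture 1 on the subgroup generated by ALL representations of dimension
`0` and the algebraic-coefficient representations of dimension `1`.** Every formal `ℤ`-combination of
such representations with vanishing evaluation is a relation: write it as a finite `ℤ`-combination of
generators (`Submodule.mem_span_set'`), lift every generator to an algebraic-coefficient representation of
dimension `1` (`tateLifting_dimZeroLiftAlg` in dimension `0`), and apply `tateLifting_dimOneAlgSector`.
[cite: Baker1975, Thm 2.1] -/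
theorem kzKernelConjecture_lowDimAlg :
    ∀ c ∈ AddSubgroup.closure
        {d : KZ.FormalRep | (∃ r : KZ.IntegralRep 0, d = KZ.of r) ∨
          ∃ (r : KZ.IntegralRep 1) (p q : Polynomial ℝ), (∀ i, IsAlgebraic ℚ (p.coeff i)) ∧
            (∀ i, IsAlgebraic ℚ (q.coeff i)) ∧ (∀ x ∈ r.domain, q.eval (x 0) ≠ 0) ∧
            Set.EqOn r.integrand (fun x => p.eval (x 0) / q.eval (x 0)) r.domain ∧ d = KZ.of r},
      KZ.eval c = 0 → c ∈ KZ.relations := by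
  intro c hc hev
  classical
  -- every generator lifts to an alg-rational representation of dimension one, modulo relations
  have hgen : ∀ d ∈ {d : KZ.FormalRep | (∃ r : KZ.IntegralRep 0, d = KZ.of r) ∨
      ∃ (r : KZ.IntegralRep 1) (p q : Polynomial ℝ), (∀ i, IsAlgebraic ℚ (p.coeff i)) ∧
        (∀ i, IsAlgebraic ℚ (q.coeff i)) ∧ (∀ x ∈ r.domain, q.eval (x 0) ≠ 0) ∧
        Set.EqOn r.integrand (fun x => p.eval (x 0) / q.eval (x 0)) r.domain ∧ d = KZ.of r},
      ∃ (ρ : KZ.IntegralRep 1) (p q : Polynomial ℝ), (∀ i, IsAlgebraic ℚ (p.coeff i)) ∧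
        (∀ i, IsAlgebraic ℚ (q.coeff i)) ∧ (∀ x ∈ ρ.domain, q.eval (x 0) ≠ 0) ∧
        Set.EqOn ρ.integrand (fun x => p.eval (x 0) / q.eval (x 0)) ρ.domain ∧
        d - KZ.of ρ ∈ KZ.relations := by
    rintro d (⟨r, rfl⟩ | ⟨r, p, q, hp, hq, hq0, hpq, rfl⟩)
    · obtain ⟨ρ, p, q, hp, hq, hq0, hpq, hrel⟩ := tateLifting_dimZeroLiftAlg r
      exact ⟨ρ, p, q, hp, hq, hq0, hpq, hrel⟩
    · exact ⟨r, p, q, hp, hq, hq0, hpq, by rw [sub_self]; exact KZ.relations.zero_mem⟩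
  rw [← Submodule.span_int_eq_addSubgroupClosure, Submodule.mem_toAddSubgroup,
    Submodule.mem_span_set'] at hc
  obtain ⟨k, f, g, rfl⟩ := hc
  choose ρ p q hp hq hq0 hpq hrel using fun i => hgen (g i) (g i).2
  have hdiff : ∑ i, f i • ((g i : KZ.FormalRep)) - ∑ i, f i • KZ.of (ρ i) ∈ KZ.relations := by
    rw [← Finset.sum_sub_distrib]
    refine sum_mem fun i _ => ?_
    rw [← smul_sub]
    exact KZ.relations.zsmul_mem (hrel i) _
  have hev' : KZ.eval (∑ i, f i • KZ.of (ρ i)) = 0 := by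
    have h0 := KZ.relations_le_ker_eval_holds hdiff
    rw [AddMonoidHom.mem_ker, map_sub, hev, zero_sub, neg_eq_zero] at h0
    exact h0
  have hker := tateLifting_dimOneAlgSector k f ρ p q (fun i => hp i) (fun i => hq i)
    (fun i => hq0 i) (fun i => hpq i) hev'
  have h := KZ.relations.add_mem hdiff hker
  rwa [sub_add_cancel] at h

/-- **Conjecture 1 for two algebraic-coefficient representations of dimension one**: if two
dimension-one integral representations with integrands `p/q`, `p'/q'` on their domains (`p, q, p', q' ∈
ℝ[x]` with real-algebraic coefficients, denominators non-vanishing on the domains) have the same value,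
they are KZ-equivalent. [cite: Baker1975, Thm 2.1] -/
theorem kzPeriodConjecture_dim_one_algCoeff :
    ∀ (r r' : KZ.IntegralRep 1) (p q p' q' : Polynomial ℝ),
      (∀ i, IsAlgebraic ℚ (p.coeff i)) → (∀ i, IsAlgebraic ℚ (q.coeff i)) →
      (∀ x ∈ r.domain, q.eval (x 0) ≠ 0) →
      Set.EqOn r.integrand (fun x => p.eval (x 0) / q.eval (x 0)) r.domain →
      (∀ i, IsAlgebraic ℚ (p'.coeff i)) → (∀ i, IsAlgebraic ℚ (q'.coeff i)) →
      (∀ x ∈ r'.domain, q'.eval (x 0) ≠ 0) →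
      Set.EqOn r'.integrand (fun x => p'.eval (x 0) / q'.eval (x 0)) r'.domain →
      r.value = r'.value → KZ.Equivalent r r' := by
  intro r r' p q p' q' hp hq hq0 hpq hp' hq' hq'0 hpq' hv
  have e : ∑ i : Fin 2, (![1, -1] : Fin 2 → ℤ) i • KZ.of ((![r, r'] : Fin 2 → KZ.IntegralRep 1) i) =
      KZ.of r - KZ.of r' := by
    rw [Fin.sum_univ_two]
    simp only [Matrix.cons_val_zero, Matrix.cons_val_one, one_smul, neg_smul, sub_eq_add_neg]
  have hev : KZ.eval (∑ i : Fin 2, (![1, -1] : Fin 2 → ℤ) i •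
      KZ.of ((![r, r'] : Fin 2 → KZ.IntegralRep 1) i)) = 0 := by
    rw [e, map_sub, KZ.eval_of, KZ.eval_of, hv, sub_self]
  have hmem := tateLifting_dimOneAlgSector 2 ![1, -1] ![r, r'] ![p, p'] ![q, q']
    (fun i => by fin_cases i <;> assumption) (fun i => by fin_cases i <;> assumption)
    (fun i => by fin_cases i <;> assumption) (fun i => by fin_cases i <;> assumption) hev
  rwa [e] at hmem

/-- **A KZ-rational representation and an algebraic-coefficient representation of dimension one with
the same value are KZ-equivalent** (the KZ-rational side is read with algebraic coefficients,
`DimOne.las_exists_algReading_of_isRational`, and `kzPeriodConjecture_dim_one_algCoeff` applies).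
[cite: Baker1975, Thm 2.1] -/
theorem kzPeriodConjecture_dim_one_rational_algCoeff :
    ∀ (r r' : KZ.IntegralRep 1) (p' q' : Polynomial ℝ), r.IsRational →
      (∀ i, IsAlgebraic ℚ (p'.coeff i)) → (∀ i, IsAlgebraic ℚ (q'.coeff i)) →
      (∀ x ∈ r'.domain, q'.eval (x 0) ≠ 0) →
      Set.EqOn r'.integrand (fun x => p'.eval (x 0) / q'.eval (x 0)) r'.domain →
      r.value = r'.value → KZ.Equivalent r r' := by
  intro r r' p' q' hr hp' hq' hq'0 hpq' hv
  obtain ⟨p, q, hp, hq, hq0, hpq⟩ := DimOne.las_exists_algReading_of_isRational r hr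
  exact kzPeriodConjecture_dim_one_algCoeff r r' p q p' q' hp hq hq0 hpq hp' hq' hq'0 hpq' hv

/-- **A representation over `ℝ⁰` and an algebraic-coefficient representation of dimension one with the
same value are KZ-equivalent** (the mixed case of Conjecture 1 in dimension `≤ 1` with algebraic
coefficients): lift the dimension-zero side (`tateLifting_dimZeroLiftAlg`) and apply
`kzPeriodConjecture_dim_one_algCoeff`. [cite: Baker1975, Thm 2.1] -/
theorem kzPeriodConjecture_dim_zero_one_algCoeff :
    ∀ (r : KZ.IntegralRep 0) (r' : KZ.IntegralRep 1) (p' q' : Polynomial ℝ),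
      (∀ i, IsAlgebraic ℚ (p'.coeff i)) → (∀ i, IsAlgebraic ℚ (q'.coeff i)) →
      (∀ x ∈ r'.domain, q'.eval (x 0) ≠ 0) →
      Set.EqOn r'.integrand (fun x => p'.eval (x 0) / q'.eval (x 0)) r'.domain →
      r.value = r'.value → KZ.Equivalent r r' := by
  intro r r' p' q' hp' hq' hq'0 hpq' hv
  obtain ⟨ρ, p, q, hp, hq, hq0, hpq, hrel⟩ := tateLifting_dimZeroLiftAlg r
  have hvρ : ρ.value = r.value := (KZ.Equivalent.value_eq_holds hrel).symm
  have h2 : KZ.Equivalent ρ r' :=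
    kzPeriodConjecture_dim_one_algCoeff ρ r' p q p' q' hp hq hq0 hpq hp' hq' hq'0 hpq' (hvρ.trans hv)
  exact KZ.Equivalent.trans hrel h2

end Summit.KontsevichZagierPeriods.InverseLandau

end
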